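import Summits.QuantumFields.GaugeBoot.Eqs.KZL2rpD4Z1o2UT1
import Summits.QuantumFields.GaugeBoot.Eqs.KZL2rpD4Z1o2UT2
import Summits.QuantumFields.GaugeBoot.Eqs.KZL2rpD4Z1o2UT3
import Summits.QuantumFields.GaugeBoot.Eqs.KZL2rpD4Z1o2UW1
import HarnessLib

/-!
# Aggregated equality row of `beta-1-2-upper.conic1.json` — assembly of the coded row (data)

Cell `pub-gaugeboot` (HOME `run/shared/lean/pub/pub-gaugeboot/`), seat lean2 (KZ aggregated equality bindings; FANOUT-PLAN A126 (2)(c) /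
A137 (1)(iii) / A146 / A152 (1)).  Certificate of record `certs/SU2-D4/kz-L2-rp/beta-1-2-upper.conic1.json` (sha256 field `507502fc85815f6e…`) over the
problem `certs/SU2-D4/kz-L2-rp/beta-1-2-upper.problem1.json` (`SU(2)`, `D = 4`, `β_std = 1/2`, 3300 equality rows, eng2's reduced form): its
2799 exact equality multipliers `lamQ` (dyadic rationals; sha256 of the multiplier list `8192596a5ab49e9c…`) contract the
equality rows into ONE row `r = Σ_e lamQ_e · row_e` (8433 labelled terms, right-hand side Σ_e lamQ_e · rhs_e = 0) — the only way
the certificate replay (lean3's `_of_feasible_agg` shape) uses the equality system.  The row is INTEGER-CODED (`Eqs/BindKitZ`: `(terms, M, K,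
witness)`, terms `tz <label code> <z>` with coefficient `z / M` exactly, witness `lz <m> <def id> <position>` = an exact combination of
2680 of the family's G1 theorem rows `KZL2rpD4LitsZ*.litZ`, `μ = Σ_e lamQ_e · Λ_e` from the seat's exact elimination witnesses `Λ`,
re-verified exactly in the seat).  Because of its size the row is spread over several modules: term pieces `…Z1o2UT<k>` and the
witness pieces `…Z1o2UW<k>` and the assembly `…Z1o2UR` (data only), and the final module `Eqs/KZL2rpD4Z1o2U` with the `m = 7` residue-class
kernel checks `chk<i>` (`Eqs/BindKitZPF.cchkZPf litZ p q 7 i` — the `BindKitZP` residue-class check with the class filter inside the combination; integer arithmetic only, one `decide` each, ≈ 21 s measured) and `Ecode`, `E_holds`, `rowSum4_row` (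
`rowSum4 1/2 L r = 0` on every torus `(ℤ/L)^4` with `L ≥ 6`).  Positivity blocks and the certificate inequalities are NOT
treated here.  GENERATED by `scratch/agg_data.py` + `scratch/gen_aggZP.py`.

HONEST FRAMING (page 1 of every file of this cell): certified bounds on lattice expectations at STATED coupling, gauge
group, dimension and torus size; NOT a mass gap, NOT a continuum limit, NOT a string tension, NOT large `N`; NOT
Yang–Mills-summit-bearing (barriers `FixedCouplingUltralocality`, `PerturbativeInvisibility`).
-/

noncomputable section

open Literature.MathematicalPhysics.QuantumFieldTheory
open Summit.QuantumFields.GaugeBoot.BindN Summit.QuantumFields.GaugeBoot.BindZ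

namespace Summit.QuantumFields.GaugeBoot.KZL2rpD4.Z1o2U

variable {L : ℕ} [NeZero L]

/-- The coded aggregated row `(terms, M, K, witness)`: 8433 terms in 3 pieces, `M = 30399297484750848` (55 bits), `K` (8 bits) = the integer scale of the check, 2680 witness entries in 1 pieces. -/
def crow : CRowZ :=
  (terms1 ++ terms2 ++ terms3, 30399297484750848,
   128,
   wit1)

end Summit.QuantumFields.GaugeBoot.KZL2rpD4.Z1o2U

end
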